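import Literature.NumberTheory.IwasawaTheory.ClassGroupPRankLeOfRelationMatrixTwo
import Literature.NumberTheory.IwasawaTheory.ClassicalMuVanishesLayerTwoRelationCertificateTwo
import Literature.NumberTheory.IwasawaTheory.ClassicalMuVanishesLayerThreeGeneralRelationCertificateTwo
import HarnessLib

/-!
# `μ₂ = 0`, `λ₂ ≤ d` FROM A `2 × 2` RELATION MATRIX AT LAYER TWO IN COORDINATES: the two-generator relation door of the cyclotomic `ℤ₂`-tower fed by
# TWO degree-one primes `𝔮₁ = (q₁, s₂ − t₁)`, `𝔮₂ = (q₂, s₂ − t₂)` of `K_2 = K·ℚ(ζ₁₆)⁺`, the generator `σ : s₂ ↦ s₂³ − 3s₂`, two exponent ROWS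
# `(e₁ | g₁)`, `(e₂ | g₂)` with `E₁G₂ − G₁E₂ = (X−1)^d·u + 2g`, `d ≤ 2`, and TWO elements `y⁽¹⁾, y⁽²⁾` with `y⁽ʳ⁾ ∈ σ^i(𝔮₁)^{e_r(i)} ∩ σ^i(𝔮₂)^{g_r(i)}` and
# `N(y⁽ʳ⁾) = ε_r q₁^{Σe_r} q₂^{Σg_r}`

`Proofs`-style file (theorems only: no definition, no named fact, no instance, no `sorry`) in topic `NumberTheory/IwasawaTheory` (namespace = path),
written by the prover seat `bsd-line-att-p3` g54 (cell `bsd-f1-sign2`, route `AlignedTransportAtTwo`; `--supports` stmt-BirchSwinnertonDyer-22298, closes nothing).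
COORDINATE KERNEL of this seat's TWO-GENERATOR RELATION DOOR (`ClassGroupPRankLeOfRelationMatrix{,Two}`, g54): the two-prime, layer-TWO analogue of att-p4 g43's
`ClassicalMuVanishesLayerThreeGeneralRelationCertificateTwo` (one prime, layer three, one generator).  HABITAT: the split-stratum fields with
`rank₂ Cl(K(√2)) = 2` (cell bsd-f1-sign2, crux C2: the cubic field of discriminant `−1727`, seeds `1727a1 / 29359b1 / 29359d1`), where the base `K` may have up to THREE
dyadic primes and EVERY unit is `≡ ±1 (mod 𝔭³)` at each of them.  Everything is stated over an abstract number field `K` (odd degree, `2 ∤ d_K`): the `(1, θ, δ)`- or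
power-basis presentation of `𝓞_K` only enters when a ROW discharges the displayed identities.

* `span_pair_sup_span_pair_eq_top_of_comax_left` — `a b + c b' = 1 ⟹ (b, z) + (b', z') = (1)` (conjugates of DIFFERENT primes are coprime).
* `prod_pow_mul_prod_pow_mulEquiv_intAut_mk0_eq_one` — ROW PLUMBING for two ideals: `∏ σ^i(𝔍₁)^{e_i} · ∏ σ^i(𝔍₂)^{g_i} = (ξ)` ⟹ the class relation
  `∏ (σ^i•[𝔍₁])^{e_i} · ∏ (σ^i•[𝔍₂])^{g_i} = 1`.
* ★★★ `classicalMuVanishes_two_of_relationMatrixCert_layer_two` — `K` odd degree, `2 ∤ d_K`, `κ` cyclotomic, at most three dyadic primes, `2 ∤ h_K`; three dyadic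
  primes `P_a, P_b, P_c` (not nec. distinct) with `𝓞_K/P = 𝔽₂` and all units `≡ ±1 (mod P³)`; DATA: `q₁, q₂ ∈ 𝓞_K` generating DISTINCT maximal ideals
  (`a q₁ + c q₂ = 1`) with the SYMBOLS `q₁ ≡ ±3 (mod P_a³)`, `q₂ ≡ ±3 (mod P_b³)`, `q₁q₂ ≡ ±3 (mod P_c³)`; `t₁, t₂ ∈ ℤ` with residue maps `ψ_k : 𝓞_K → ℤ/m_k`
  (`ψ_k q_k = 0`, `P₂(t_k) = (t_k²−2)²−2 = 0`, `2` invertible); Bézout data `α_k q_k⁴ + β_k P₂(t_k) = q_k`; coprimality witnesses `α_{kj} q_k + v_{kj} p_j(t_k) = 1`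
  (`p₁ = t³ − 4t`, `p₂ = −2t`, `p₃ = −t³ + 2t`); exponent rows `e₁, g₁, e₂, g₂ : ℕ → ℕ` (values at `0…3`) with
  `(Σ e₁(i)Xⁱ)(Σ g₂(i)Xⁱ) − (Σ g₁(i)Xⁱ)(Σ e₂(i)Xⁱ) = (X−1)^d·u + 2g`, `u(1)` odd, `d + 2 ≤ 4`; for each row `r` an element `y⁽ʳ⁾` (four coordinates on `1, s₁, s₂, s₁s₂`) with
  EIGHT membership certificates `y⁽ʳ⁾ = Σ_k c_k q^{e−k} (σ^i s₂ − t)^k` (universally quantified over commutative rings with `S₁² = 2`, `S₂² = 2 + S₁`) and the norm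
  `V₀² − 2V₁² = ε_r q₁^{Σe_r} q₂^{Σg_r}` ⟹ **`rank₂ Cl(K_l) ≤ d ∀ l`, `μ₂(κ) = 0`, `λ₂(κ) ≤ d`**.

WHY IT IS A PROOF.  `𝔮_k = (q_k, S₂ − t_k)` is proper (residue symbol) with `N_{K_2/K}(𝔮_k) ⊇ (q_k⁴, P₂(t_k)) ∋ q_k`, so `N(𝔮_k) = (q_k)`; the four conjugates of each `𝔮_k` are
pairwise coprime (the three witnesses) and coprime to those of the other prime (`a q₁ + c q₂ = 1`); the memberships put `y⁽ʳ⁾` in `⋂ = ∏ =: A_r`, and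
`N((y⁽ʳ⁾)) = N(A_r) = (q₁)^{Σe_r}(q₂)^{Σg_r}` forces `(y⁽ʳ⁾) = A_r` (Dedekind cancellation); then the class relations (row plumbing), the genus certificates
`N_{K_2/K_1}𝔮₁`, `N_{K_2/K_1}𝔮₂`, `N_{K_2/K_1}(𝔮₁𝔮₂)` (norms `(q₁)`, `(q₂)`, `(q₁q₂)`), and this seat's `classicalMuVanishes_two_of_relation_matrix_of_three_genusCerts`.

HONEST SCOPE: classical; nothing about any summit is asserted here; no field's data is certified here; BSD is not advanced.

References: [Washington1997] §13.1, §13.3 Prop. 13.22–13.23; [Lang1990] Ch. 5 §3, Ch. 13 §4 Lemma 4.1; [Fukuda1994] Thm. 1; [Gras2003] IV.4; [NeukirchANT1999] Ch. I §2,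
§3 (3.3), §8, §9 (9.6), Ch. III (1.6)–(1.7); [Cohen1993] §4.7, §6.5; [Omeara1963] §63B.
-/

set_option autoImplicit false

noncomputable section

open scoped NumberField nonZeroDivisors
open NumberField IsDedekindDomain Module Polynomial Finset

namespace Literature.NumberTheory.IwasawaTheory

open Literature.NumberTheory.EllipticCurves Literature.NumberTheory.NumberFields Literature.NumberTheory.NumberFields.AmbiguousClass

/-! ## §0 Plumbing -/

section Plumbing

/-- `a b + c b' = 1 ⟹ (b, z) + (b', z') = (1)`: conjugates of two DIFFERENT degree-one primes are coprime. [cite: NeukirchANT1999, Ch. I §3 (3.1)–(3.3)]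
[cite: Cohen1993, §4.7] -/
theorem span_pair_sup_span_pair_eq_top_of_comax_left {R : Type*} [CommRing R] {a b c b' : R} (z z' : R) (h : a * b + c * b' = 1) :
    Ideal.span {b, z} ⊔ Ideal.span {b', z'} = ⊤ := by
  rw [Ideal.eq_top_iff_one, ← h]
  exact Submodule.add_mem_sup (Ideal.mul_mem_left _ _ (Ideal.subset_span (by simp))) (Ideal.mul_mem_left _ _ (Ideal.subset_span (by simp)))

variable {F L : Type} [Field F] [Field L] [NumberField L] [Algebra F L]

/-- **Row plumbing for TWO ideals.**  If `∏_{i<N} σ^i(𝔍₁)^{e_i} · ∏_{i<N} σ^i(𝔍₂)^{g_i} = (ξ)` as ideals of `𝓞_L`, then the classes satisfy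
**`∏_{i<N} (σ^i•[𝔍₁])^{e_i} · ∏_{i<N} (σ^i•[𝔍₂])^{g_i} = 1`** in `Cl(L)` — the hypothesis `hrel` of the two-generator relation door with non-negative exponents.
[cite: NeukirchANT1999, Ch. I §9 (9.6) and §3 (the class group)] -/
theorem prod_pow_mul_prod_pow_mulEquiv_intAut_mk0_eq_one (σ : L ≃ₐ[F] L) {J₁ J₂ : Ideal (𝓞 L)} (hJ₁ : J₁ ≠ ⊥) (hJ₂ : J₂ ≠ ⊥) {N : ℕ} {e g : ℕ → ℕ}
    {ξ : 𝓞 L} (h : (∏ i ∈ range N, (J₁.map (intAut (σ ^ i) : 𝓞 L →+* 𝓞 L)) ^ e i) * ∏ i ∈ range N, (J₂.map (intAut (σ ^ i) : 𝓞 L →+* 𝓞 L)) ^ g i =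
      Ideal.span {ξ}) :
    (∏ i ∈ range N, (ClassGroup.mulEquiv (intAut (σ ^ i)) (ClassGroup.mk0 ⟨J₁, mem_nonZeroDivisors_of_ne_zero hJ₁⟩)) ^ (e i : ℤ)) *
      ∏ i ∈ range N, (ClassGroup.mulEquiv (intAut (σ ^ i)) (ClassGroup.mk0 ⟨J₂, mem_nonZeroDivisors_of_ne_zero hJ₂⟩)) ^ (g i : ℤ) = 1 := by
  classical
  set J₁nz : (Ideal (𝓞 L))⁰ := ⟨J₁, mem_nonZeroDivisors_of_ne_zero hJ₁⟩ with hJ₁nz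
  set J₂nz : (Ideal (𝓞 L))⁰ := ⟨J₂, mem_nonZeroDivisors_of_ne_zero hJ₂⟩ with hJ₂nz
  have hconj₁ : ∀ i, ClassGroup.mulEquiv (intAut (σ ^ i)) (ClassGroup.mk0 J₁nz) =
      ClassGroup.mk0 ⟨_, map_mem_nonZeroDivisors (σ ^ i) J₁nz⟩ := fun i => mulEquiv_mk0 (σ ^ i) J₁nz
  have hconj₂ : ∀ i, ClassGroup.mulEquiv (intAut (σ ^ i)) (ClassGroup.mk0 J₂nz) =
      ClassGroup.mk0 ⟨_, map_mem_nonZeroDivisors (σ ^ i) J₂nz⟩ := fun i => mulEquiv_mk0 (σ ^ i) J₂nz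
  simp_rw [zpow_natCast, hconj₁, hconj₂, ← map_pow, ← map_prod, ← map_mul]
  rw [ClassGroup.mk0_eq_one_iff]
  have hval : ((((∏ i ∈ range N, (⟨_, map_mem_nonZeroDivisors (σ ^ i) J₁nz⟩ : (Ideal (𝓞 L))⁰) ^ e i) *
      ∏ i ∈ range N, (⟨_, map_mem_nonZeroDivisors (σ ^ i) J₂nz⟩ : (Ideal (𝓞 L))⁰) ^ g i : (Ideal (𝓞 L))⁰)) : Ideal (𝓞 L)) =
      (∏ i ∈ range N, (J₁.map (intAut (σ ^ i) : 𝓞 L →+* 𝓞 L)) ^ e i) * ∏ i ∈ range N, (J₂.map (intAut (σ ^ i) : 𝓞 L →+* 𝓞 L)) ^ g i := by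
    rw [Submonoid.coe_mul, SubmonoidClass.coe_finsetProd, SubmonoidClass.coe_finsetProd]
    congr 1
  rw [hval, h]
  exact ⟨⟨ξ, by rw [Ideal.submodule_span_eq]⟩⟩

end Plumbing

/-! ## §1 The two-prime relation-matrix certificate at layer two -/

section Layer

variable {K : Type} [Field K] [NumberField K]

set_option maxHeartbeats 6400000 in
set_option synthInstance.maxHeartbeats 400000 in
/-- ★★★ **`μ₂ = 0`, `λ₂ ≤ d`, `rank₂ Cl(K_l) ≤ d ∀ l` FROM A `2 × 2` RELATION MATRIX AT LAYER TWO IN COORDINATES** (two degree-one primes `(q_k, s₂ − t_k)` of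
`K_2`, three dyadic symbols, two exponent rows with determinant `(X−1)^d·u + 2g`, `d + 2 ≤ 4`, two elements certified by memberships and norms — see the module
docstring). [cite: Washington1997, §13.3 Prop. 13.22–13.23] [cite: Lang1990, Ch. 5 §3, Ch. 13 §4 Lemma 4.1] [cite: NeukirchANT1999, Ch. III (1.6)–(1.7); Ch. I §3 (3.3)]
[cite: Cohen1993, §4.7, §6.5] [cite: Gras2003, IV.4] -/
theorem classicalMuVanishes_two_of_relationMatrixCert_layer_two (hK2 : ¬ 2 ∣ Module.finrank ℚ K) (hd : ¬ (2 : ℤ) ∣ NumberField.discr K)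
    (κ : ZpExtension K 2) (hκ : κ.IsCyclotomic)
    (h3 : {w : HeightOneSpectrum (𝓞 K) | ((2 : ℕ) : 𝓞 K) ∈ w.asIdeal}.ncard ≤ 3)
    (hh : ¬ 2 ∣ classNumber K)
    (Pa : Ideal (𝓞 K)) [Pa.IsMaximal] (hresa : ∀ r : 𝓞 K, r ∈ Pa ∨ r - 1 ∈ Pa) (h2Pa : (2 : 𝓞 K) ∈ Pa)
    (hunitsa : ∀ w : (𝓞 K)ˣ, (w : 𝓞 K) - 1 ∈ Pa ^ 3 ∨ (w : 𝓞 K) + 1 ∈ Pa ^ 3)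
    (Pb : Ideal (𝓞 K)) [Pb.IsMaximal] (hresb : ∀ r : 𝓞 K, r ∈ Pb ∨ r - 1 ∈ Pb) (h2Pb : (2 : 𝓞 K) ∈ Pb)
    (hunitsb : ∀ w : (𝓞 K)ˣ, (w : 𝓞 K) - 1 ∈ Pb ^ 3 ∨ (w : 𝓞 K) + 1 ∈ Pb ^ 3)
    (Pc : Ideal (𝓞 K)) [Pc.IsMaximal] (hresc : ∀ r : 𝓞 K, r ∈ Pc ∨ r - 1 ∈ Pc) (h2Pc : (2 : 𝓞 K) ∈ Pc)
    (hunitsc : ∀ w : (𝓞 K)ˣ, (w : 𝓞 K) - 1 ∈ Pc ^ 3 ∨ (w : 𝓞 K) + 1 ∈ Pc ^ 3)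
    -- the two primes below: `q₁, q₂` generate distinct maximal ideals; dyadic symbols for `q₁` at `P_a`, `q₂` at `P_b`, `q₁q₂` at `P_c`
    (q₁ q₂ : 𝓞 K) (hq₁ : (Ideal.span {q₁}).IsMaximal) (hq₂ : (Ideal.span {q₂}).IsMaximal)
    (a₁₂ c₁₂ : 𝓞 K) (hq₁₂ : a₁₂ * q₁ + c₁₂ * q₂ = 1)
    (hπa : q₁ - 3 ∈ Pa ^ 3 ∨ q₁ + 3 ∈ Pa ^ 3) (hπb : q₂ - 3 ∈ Pb ^ 3 ∨ q₂ + 3 ∈ Pb ^ 3) (hπc : q₁ * q₂ - 3 ∈ Pc ^ 3 ∨ q₁ * q₂ + 3 ∈ Pc ^ 3)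
    -- the two primes above: `(q_k, s₂ − t_k)`, residue symbols, norm Bézout data, coprimality of the four conjugates
    (t₁ t₂ : ℤ) {m₁ m₂ : ℕ} (hm₁ : 1 < m₁) (hm₂ : 1 < m₂) (ψ₁ : 𝓞 K →+* ZMod m₁) (ψ₂ : 𝓞 K →+* ZMod m₂) (hψ₁ : ψ₁ q₁ = 0) (hψ₂ : ψ₂ q₂ = 0)
    {ti₁ : ZMod m₁} {ti₂ : ZMod m₂} (hti₁ : 2 * ti₁ = 1) (hti₂ : 2 * ti₂ = 1)
    (hPt₁ : ((t₁ : ZMod m₁) ^ 2 - 2) ^ 2 - 2 = 0) (hPt₂ : ((t₂ : ZMod m₂) ^ 2 - 2) ^ 2 - 2 = 0)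
    (α₁ β₁ : 𝓞 K) (hBez₁ : α₁ * q₁ ^ 4 + β₁ * (((t₁ : 𝓞 K) ^ 2 - 2) ^ 2 - 2) = q₁)
    (α₂ β₂ : 𝓞 K) (hBez₂ : α₂ * q₂ ^ 4 + β₂ * (((t₂ : 𝓞 K) ^ 2 - 2) ^ 2 - 2) = q₂)
    (α₁₁ v₁₁ : 𝓞 K) (hC₁₁ : α₁₁ * q₁ + v₁₁ * ((t₁ : 𝓞 K) ^ 3 - 4 * (t₁ : 𝓞 K)) = 1)
    (α₁₂ v₁₂ : 𝓞 K) (hC₁₂ : α₁₂ * q₁ + v₁₂ * (-2 * (t₁ : 𝓞 K)) = 1)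
    (α₁₃ v₁₃ : 𝓞 K) (hC₁₃ : α₁₃ * q₁ + v₁₃ * (-(t₁ : 𝓞 K) ^ 3 + 2 * (t₁ : 𝓞 K)) = 1)
    (α₂₁ v₂₁ : 𝓞 K) (hC₂₁ : α₂₁ * q₂ + v₂₁ * ((t₂ : 𝓞 K) ^ 3 - 4 * (t₂ : 𝓞 K)) = 1)
    (α₂₂ v₂₂ : 𝓞 K) (hC₂₂ : α₂₂ * q₂ + v₂₂ * (-2 * (t₂ : 𝓞 K)) = 1)
    (α₂₃ v₂₃ : 𝓞 K) (hC₂₃ : α₂₃ * q₂ + v₂₃ * (-(t₂ : 𝓞 K) ^ 3 + 2 * (t₂ : 𝓞 K)) = 1)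
    -- the two exponent rows and their determinant
    (e₁ g₁ e₂ g₂ : ℕ → ℕ) {d : ℕ} (hd2 : d + 2 ≤ 4) {u g : ℤ[X]} (hu : ¬ (2 : ℤ) ∣ u.eval 1)
    (hF : (∑ i ∈ range 4, C ((e₁ i : ℕ) : ℤ) * X ^ i : ℤ[X]) * (∑ i ∈ range 4, C ((g₂ i : ℕ) : ℤ) * X ^ i) -
        (∑ i ∈ range 4, C ((g₁ i : ℕ) : ℤ) * X ^ i) * (∑ i ∈ range 4, C ((e₂ i : ℕ) : ℤ) * X ^ i) = (X - 1) ^ d * u + C (2 : ℤ) * g)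
    -- row 1: `y = y₀ + y₁ s₁ + (y₂ + y₃ s₁) s₂` with eight memberships and its norm
    (y₀ y₁ y₂ y₃ : 𝓞 K)
    (hy1q0 : ∀ (R : Type) [CommRing R] (φ : 𝓞 K →+* R) (S₁ S₂ : R), S₁ ^ 2 = 2 → S₂ ^ 2 = 2 + S₁ →
      ∃ c : ℕ → R, φ y₀ + φ y₁ * S₁ + (φ y₂ + φ y₃ * S₁) * S₂ =
        ∑ k ∈ Finset.range (e₁ 0 + 1), c k * φ q₁ ^ (e₁ 0 - k) * (S₂ - (t₁ : R)) ^ k)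
    (hy1q1 : ∀ (R : Type) [CommRing R] (φ : 𝓞 K →+* R) (S₁ S₂ : R), S₁ ^ 2 = 2 → S₂ ^ 2 = 2 + S₁ →
      ∃ c : ℕ → R, φ y₀ + φ y₁ * S₁ + (φ y₂ + φ y₃ * S₁) * S₂ =
        ∑ k ∈ Finset.range (e₁ 1 + 1), c k * φ q₁ ^ (e₁ 1 - k) * (S₁ * S₂ - S₂ - (t₁ : R)) ^ k)
    (hy1q2 : ∀ (R : Type) [CommRing R] (φ : 𝓞 K →+* R) (S₁ S₂ : R), S₁ ^ 2 = 2 → S₂ ^ 2 = 2 + S₁ →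
      ∃ c : ℕ → R, φ y₀ + φ y₁ * S₁ + (φ y₂ + φ y₃ * S₁) * S₂ =
        ∑ k ∈ Finset.range (e₁ 2 + 1), c k * φ q₁ ^ (e₁ 2 - k) * (-S₂ - (t₁ : R)) ^ k)
    (hy1q3 : ∀ (R : Type) [CommRing R] (φ : 𝓞 K →+* R) (S₁ S₂ : R), S₁ ^ 2 = 2 → S₂ ^ 2 = 2 + S₁ →
      ∃ c : ℕ → R, φ y₀ + φ y₁ * S₁ + (φ y₂ + φ y₃ * S₁) * S₂ =
        ∑ k ∈ Finset.range (e₁ 3 + 1), c k * φ q₁ ^ (e₁ 3 - k) * (S₂ - S₁ * S₂ - (t₁ : R)) ^ k)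
    (hy2q0 : ∀ (R : Type) [CommRing R] (φ : 𝓞 K →+* R) (S₁ S₂ : R), S₁ ^ 2 = 2 → S₂ ^ 2 = 2 + S₁ →
      ∃ c : ℕ → R, φ y₀ + φ y₁ * S₁ + (φ y₂ + φ y₃ * S₁) * S₂ =
        ∑ k ∈ Finset.range (g₁ 0 + 1), c k * φ q₂ ^ (g₁ 0 - k) * (S₂ - (t₂ : R)) ^ k)
    (hy2q1 : ∀ (R : Type) [CommRing R] (φ : 𝓞 K →+* R) (S₁ S₂ : R), S₁ ^ 2 = 2 → S₂ ^ 2 = 2 + S₁ →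
      ∃ c : ℕ → R, φ y₀ + φ y₁ * S₁ + (φ y₂ + φ y₃ * S₁) * S₂ =
        ∑ k ∈ Finset.range (g₁ 1 + 1), c k * φ q₂ ^ (g₁ 1 - k) * (S₁ * S₂ - S₂ - (t₂ : R)) ^ k)
    (hy2q2 : ∀ (R : Type) [CommRing R] (φ : 𝓞 K →+* R) (S₁ S₂ : R), S₁ ^ 2 = 2 → S₂ ^ 2 = 2 + S₁ →
      ∃ c : ℕ → R, φ y₀ + φ y₁ * S₁ + (φ y₂ + φ y₃ * S₁) * S₂ =
        ∑ k ∈ Finset.range (g₁ 2 + 1), c k * φ q₂ ^ (g₁ 2 - k) * (-S₂ - (t₂ : R)) ^ k)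
    (hy2q3 : ∀ (R : Type) [CommRing R] (φ : 𝓞 K →+* R) (S₁ S₂ : R), S₁ ^ 2 = 2 → S₂ ^ 2 = 2 + S₁ →
      ∃ c : ℕ → R, φ y₀ + φ y₁ * S₁ + (φ y₂ + φ y₃ * S₁) * S₂ =
        ∑ k ∈ Finset.range (g₁ 3 + 1), c k * φ q₂ ^ (g₁ 3 - k) * (S₂ - S₁ * S₂ - (t₂ : R)) ^ k)
    (εy : (𝓞 K)ˣ) (hNy : (y₀ ^ 2 + 2 * y₁ ^ 2 - 2 * y₂ ^ 2 - 4 * y₃ ^ 2 - 4 * y₂ * y₃) ^ 2 - 2 * (2 * y₀ * y₁ - y₂ ^ 2 - 2 * y₃ ^ 2 - 4 * y₂ * y₃) ^ 2 =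
      εy * q₁ ^ (∑ i ∈ range 4, e₁ i) * q₂ ^ (∑ i ∈ range 4, g₁ i))
    -- row 2: `z = z₀ + z₁ s₁ + (z₂ + z₃ s₁) s₂`
    (z₀ z₁ z₂ z₃ : 𝓞 K)
    (hz1q0 : ∀ (R : Type) [CommRing R] (φ : 𝓞 K →+* R) (S₁ S₂ : R), S₁ ^ 2 = 2 → S₂ ^ 2 = 2 + S₁ →
      ∃ c : ℕ → R, φ z₀ + φ z₁ * S₁ + (φ z₂ + φ z₃ * S₁) * S₂ =
        ∑ k ∈ Finset.range (e₂ 0 + 1), c k * φ q₁ ^ (e₂ 0 - k) * (S₂ - (t₁ : R)) ^ k)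
    (hz1q1 : ∀ (R : Type) [CommRing R] (φ : 𝓞 K →+* R) (S₁ S₂ : R), S₁ ^ 2 = 2 → S₂ ^ 2 = 2 + S₁ →
      ∃ c : ℕ → R, φ z₀ + φ z₁ * S₁ + (φ z₂ + φ z₃ * S₁) * S₂ =
        ∑ k ∈ Finset.range (e₂ 1 + 1), c k * φ q₁ ^ (e₂ 1 - k) * (S₁ * S₂ - S₂ - (t₁ : R)) ^ k)
    (hz1q2 : ∀ (R : Type) [CommRing R] (φ : 𝓞 K →+* R) (S₁ S₂ : R), S₁ ^ 2 = 2 → S₂ ^ 2 = 2 + S₁ →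
      ∃ c : ℕ → R, φ z₀ + φ z₁ * S₁ + (φ z₂ + φ z₃ * S₁) * S₂ =
        ∑ k ∈ Finset.range (e₂ 2 + 1), c k * φ q₁ ^ (e₂ 2 - k) * (-S₂ - (t₁ : R)) ^ k)
    (hz1q3 : ∀ (R : Type) [CommRing R] (φ : 𝓞 K →+* R) (S₁ S₂ : R), S₁ ^ 2 = 2 → S₂ ^ 2 = 2 + S₁ →
      ∃ c : ℕ → R, φ z₀ + φ z₁ * S₁ + (φ z₂ + φ z₃ * S₁) * S₂ =
        ∑ k ∈ Finset.range (e₂ 3 + 1), c k * φ q₁ ^ (e₂ 3 - k) * (S₂ - S₁ * S₂ - (t₁ : R)) ^ k)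
    (hz2q0 : ∀ (R : Type) [CommRing R] (φ : 𝓞 K →+* R) (S₁ S₂ : R), S₁ ^ 2 = 2 → S₂ ^ 2 = 2 + S₁ →
      ∃ c : ℕ → R, φ z₀ + φ z₁ * S₁ + (φ z₂ + φ z₃ * S₁) * S₂ =
        ∑ k ∈ Finset.range (g₂ 0 + 1), c k * φ q₂ ^ (g₂ 0 - k) * (S₂ - (t₂ : R)) ^ k)
    (hz2q1 : ∀ (R : Type) [CommRing R] (φ : 𝓞 K →+* R) (S₁ S₂ : R), S₁ ^ 2 = 2 → S₂ ^ 2 = 2 + S₁ →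
      ∃ c : ℕ → R, φ z₀ + φ z₁ * S₁ + (φ z₂ + φ z₃ * S₁) * S₂ =
        ∑ k ∈ Finset.range (g₂ 1 + 1), c k * φ q₂ ^ (g₂ 1 - k) * (S₁ * S₂ - S₂ - (t₂ : R)) ^ k)
    (hz2q2 : ∀ (R : Type) [CommRing R] (φ : 𝓞 K →+* R) (S₁ S₂ : R), S₁ ^ 2 = 2 → S₂ ^ 2 = 2 + S₁ →
      ∃ c : ℕ → R, φ z₀ + φ z₁ * S₁ + (φ z₂ + φ z₃ * S₁) * S₂ =
        ∑ k ∈ Finset.range (g₂ 2 + 1), c k * φ q₂ ^ (g₂ 2 - k) * (-S₂ - (t₂ : R)) ^ k)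
    (hz2q3 : ∀ (R : Type) [CommRing R] (φ : 𝓞 K →+* R) (S₁ S₂ : R), S₁ ^ 2 = 2 → S₂ ^ 2 = 2 + S₁ →
      ∃ c : ℕ → R, φ z₀ + φ z₁ * S₁ + (φ z₂ + φ z₃ * S₁) * S₂ =
        ∑ k ∈ Finset.range (g₂ 3 + 1), c k * φ q₂ ^ (g₂ 3 - k) * (S₂ - S₁ * S₂ - (t₂ : R)) ^ k)
    (εz : (𝓞 K)ˣ) (hNz : (z₀ ^ 2 + 2 * z₁ ^ 2 - 2 * z₂ ^ 2 - 4 * z₃ ^ 2 - 4 * z₂ * z₃) ^ 2 - 2 * (2 * z₀ * z₁ - z₂ ^ 2 - 2 * z₃ ^ 2 - 4 * z₂ * z₃) ^ 2 =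
      εz * q₁ ^ (∑ i ∈ range 4, e₂ i) * q₂ ^ (∑ i ∈ range 4, g₂ i)) :
    (∀ l, classGroupPRank κ l ≤ d) ∧ ClassicalMuVanishes κ ∧ classicalLambda κ ≤ d := by
  classical
  haveI : Fact (Nat.Prime 2) := ⟨Nat.prime_two⟩
  -- ### the layers `K₁ ⊂ K₂`
  have h12 : κ.layer 1 ≤ κ.layer 2 := κ.layer_mono one_le_two
  letI alg12 : Algebra (κ.layer 1) (κ.layer 2) := (IntermediateField.inclusion h12).toRingHom.toAlgebra
  haveI tow12 : IsScalarTower K (κ.layer 1) (κ.layer 2) :=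
    IsScalarTower.of_algebraMap_eq fun x => ((IntermediateField.inclusion h12).commutes x).symm
  letI : Algebra (κ.layer 1) (κ.layer (1 + 1)) := alg12
  haveI : IsScalarTower K (κ.layer 1) (κ.layer (1 + 1)) := tow12
  haveI : FiniteDimensional K (κ.layer 1) := κ.finiteDimensional_layer_holds 1
  haveI : FiniteDimensional K (κ.layer 2) := κ.finiteDimensional_layer_holds 2
  haveI : NumberField (κ.layer 1) := NumberField.of_module_finite K _
  haveI : NumberField (κ.layer 2) := NumberField.of_module_finite K _
  haveI : IsGalois K (κ.layer 1) := κ.isGalois_layer_holds 1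
  haveI : IsGalois K (κ.layer 2) := κ.isGalois_layer_holds 2
  haveI : IsGalois (κ.layer 1) (κ.layer 2) := IsGalois.tower_top_of_isGalois K _ _
  haveI : FiniteDimensional (κ.layer 1) (κ.layer 2) := Module.Finite.of_restrictScalars_finite K _ _
  have hdeg1 : Module.finrank K (κ.layer 1) = 2 := by rw [κ.finrank_layer_holds 1, pow_one]
  have hdeg2 : Module.finrank (κ.layer 1) (κ.layer 2) = 2 := finrank_layer_one_layer_two κ
  have hdeg4 : Module.finrank K (κ.layer 2) = 4 := by rw [κ.finrank_layer_holds 2]; norm_num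
  -- ### generators `s₁ ∈ K₁`, `s₂ ∈ K₂` and integral copies `S₁, S₂ ∈ 𝓞 K₂`
  obtain ⟨s₁, hs₁, s₂', hs₂', hs₂K''⟩ := exists_sqrt_two_layer_one_sqrt_two_add_layer_two κ hK2 hκ
  set s₂ : κ.layer 2 := s₂' with hs₂def
  have hs₂ : s₂ ^ 2 = algebraMap (κ.layer 1) (κ.layer 2) (2 + s₁) := hs₂'
  have hs₂K : ∀ x : κ.layer 1, algebraMap (κ.layer 1) (κ.layer 2) x ≠ s₂ := fun x hx => hs₂K'' ⟨x, hx⟩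
  clear_value s₂
  clear hs₂' hs₂K'' hs₂def
  have hs₁K : ∀ x : K, algebraMap K (κ.layer 1) x ≠ s₁ := forall_algebraMap_ne_of_sq_eq_two hd hs₁
  have hs₁int : IsIntegral ℤ s₁ := by
    refine ⟨Polynomial.X ^ 2 - Polynomial.C 2, Polynomial.monic_X_pow_sub_C _ two_ne_zero, ?_⟩
    simp [hs₁]
  have h2int : IsIntegral ℤ (2 : κ.layer 2) := by
    have := isIntegral_algebraMap (R := ℤ) (A := κ.layer 2) (x := (2 : ℤ))
    rwa [map_ofNat] at this
  have hs₂int : IsIntegral ℤ s₂ := by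
    refine IsIntegral.of_pow (n := 2) (by norm_num) ?_
    rw [hs₂, map_add, map_ofNat]
    exact h2int.add (map_isIntegral_int _ hs₁int)
  obtain ⟨S₁, hS₁val⟩ : ∃ S : 𝓞 (κ.layer 2), algebraMap (𝓞 (κ.layer 2)) (κ.layer 2) S = algebraMap (κ.layer 1) (κ.layer 2) s₁ :=
    ⟨⟨_, map_isIntegral_int (algebraMap (κ.layer 1) (κ.layer 2)) hs₁int⟩, rfl⟩
  obtain ⟨S₂, hS₂val⟩ : ∃ S : 𝓞 (κ.layer 2), algebraMap (𝓞 (κ.layer 2)) (κ.layer 2) S = s₂ := ⟨⟨_, hs₂int⟩, rfl⟩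
  have hT₁ : (algebraMap (κ.layer 1) (κ.layer 2) s₁) ^ 2 = 2 := by rw [← map_pow, hs₁, map_ofNat]
  have hT₂ : s₂ ^ 2 = 2 + algebraMap (κ.layer 1) (κ.layer 2) s₁ := by rw [hs₂, map_add, map_ofNat]
  have hS₁ : S₁ ^ 2 = 2 := by
    apply RingOfIntegers.coe_injective
    rw [map_pow, map_ofNat, hS₁val]; exact hT₁
  have hS₂ : S₂ ^ 2 = 2 + S₁ := by
    apply RingOfIntegers.coe_injective
    rw [map_pow, map_add, map_ofNat, hS₂val, hS₁val]; exact hT₂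
  set f := algebraMap (𝓞 K) (𝓞 (κ.layer 2)) with hf
  have hcoe : ∀ w : 𝓞 K, algebraMap (𝓞 (κ.layer 2)) (κ.layer 2) (f w) = algebraMap K (κ.layer 2) (w : K) := fun w => by
    rw [hf]
    exact (IsScalarTower.algebraMap_apply (𝓞 K) (𝓞 (κ.layer 2)) (κ.layer 2) w).symm.trans
      (IsScalarTower.algebraMap_apply (𝓞 K) K (κ.layer 2) w)
  have hia : ∀ (τ : (κ.layer 2) ≃ₐ[K] (κ.layer 2)) (x : 𝓞 (κ.layer 2)),
      algebraMap (𝓞 (κ.layer 2)) (κ.layer 2) ((intAut τ : 𝓞 (κ.layer 2) →+* 𝓞 (κ.layer 2)) x) = τ (algebraMap (𝓞 (κ.layer 2)) (κ.layer 2) x) :=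
    fun τ x => rfl
  -- ### the generator `σ` of `Gal(K₂/K)` with `σ s₂ = s₂³ − 3 s₂`
  obtain ⟨σ, hσ⟩ := exists_algEquiv_apply_eq_tower2 (K := K) hdeg1 hdeg2 hs₁ hs₁K hs₂ hs₂K
  have hgen : ∀ τ : (κ.layer 2) ≃ₐ[K] (κ.layer 2), τ ∈ Subgroup.zpowers σ :=
    forall_mem_zpowers_of_apply_eq_tower2 (K := K) hdeg1 hdeg2 hs₁ hs₁K hs₂ hσ
  obtain ⟨-, hσ1, hσ2, hσ3⟩ := tower2_galois_iterates (K := K) hs₁ hs₂ hσ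
  have hcomp : ∀ i k : ℕ, (intAut (σ ^ i) : 𝓞 (κ.layer 2) →+* 𝓞 (κ.layer 2)).comp (intAut (σ ^ k) : 𝓞 (κ.layer 2) →+* 𝓞 (κ.layer 2)) =
      (intAut (σ ^ (i + k)) : 𝓞 (κ.layer 2) →+* 𝓞 (κ.layer 2)) := by
    intro i k
    refine RingHom.ext fun x => RingOfIntegers.coe_injective ?_
    rw [RingHom.comp_apply, hia, hia, hia, ← AlgEquiv.mul_apply, ← pow_add]
  -- ### conjugates of the elements `σ^i S₂ − t`
  have hZ₀ : ∀ t : ℤ, algebraMap (𝓞 (κ.layer 2)) (κ.layer 2) (S₂ - (t : 𝓞 (κ.layer 2))) = (σ ^ 0) s₂ - t := fun t => by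
    rw [pow_zero, AlgEquiv.one_apply, map_sub, map_intCast, hS₂val]
  have hZ₁ : ∀ t : ℤ, algebraMap (𝓞 (κ.layer 2)) (κ.layer 2) (S₁ * S₂ - S₂ - (t : 𝓞 (κ.layer 2))) = (σ ^ 1) s₂ - t := fun t => by
    rw [pow_one, hσ1, map_sub, map_sub, map_mul, map_intCast, hS₂val, hS₁val]
  have hZ₂ : ∀ t : ℤ, algebraMap (𝓞 (κ.layer 2)) (κ.layer 2) (-S₂ - (t : 𝓞 (κ.layer 2))) = (σ ^ 2) s₂ - t := fun t => by
    rw [hσ2, map_sub, map_neg, map_intCast, hS₂val]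
  have hZ₃ : ∀ t : ℤ, algebraMap (𝓞 (κ.layer 2)) (κ.layer 2) (S₂ - S₁ * S₂ - (t : 𝓞 (κ.layer 2))) = (σ ^ 3) s₂ - t := fun t => by
    rw [hσ3, map_sub, map_sub, map_mul, map_intCast, hS₂val, hS₁val]
  -- ### ONE PRIME `(q, S₂ − t)`: the ideal, its conjugates, coprimality, norm — uniformly in the data
  have prime_block : ∀ (q : 𝓞 K) (hq : (Ideal.span {q}).IsMaximal) (t : ℤ) {m : ℕ} (hm : 1 < m) (ψ : 𝓞 K →+* ZMod m) (hψ : ψ q = 0)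
      {ti : ZMod m} (hti : 2 * ti = 1) (hPt : ((t : ZMod m) ^ 2 - 2) ^ 2 - 2 = 0)
      (α β : 𝓞 K) (hBez : α * q ^ 4 + β * (((t : 𝓞 K) ^ 2 - 2) ^ 2 - 2) = q)
      (αa va : 𝓞 K) (hCa : αa * q + va * ((t : 𝓞 K) ^ 3 - 4 * (t : 𝓞 K)) = 1)
      (αb vb : 𝓞 K) (hCb : αb * q + vb * (-2 * (t : 𝓞 K)) = 1)
      (αc vc : 𝓞 K) (hCc : αc * q + vc * (-(t : 𝓞 K) ^ 3 + 2 * (t : 𝓞 K)) = 1),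
      f q ≠ 0 ∧ Ideal.span {f q, S₂ - (t : 𝓞 (κ.layer 2))} ≠ ⊥ ∧
      (Ideal.span {f q, S₂ - (t : 𝓞 (κ.layer 2))}).map (intAut (σ ^ 0) : 𝓞 (κ.layer 2) →+* 𝓞 (κ.layer 2)) = Ideal.span {f q, S₂ - (t : 𝓞 (κ.layer 2))} ∧
      (Ideal.span {f q, S₂ - (t : 𝓞 (κ.layer 2))}).map (intAut (σ ^ 1) : 𝓞 (κ.layer 2) →+* 𝓞 (κ.layer 2)) = Ideal.span {f q, S₁ * S₂ - S₂ - (t : 𝓞 (κ.layer 2))} ∧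
      (Ideal.span {f q, S₂ - (t : 𝓞 (κ.layer 2))}).map (intAut (σ ^ 2) : 𝓞 (κ.layer 2) →+* 𝓞 (κ.layer 2)) = Ideal.span {f q, -S₂ - (t : 𝓞 (κ.layer 2))} ∧
      (Ideal.span {f q, S₂ - (t : 𝓞 (κ.layer 2))}).map (intAut (σ ^ 3) : 𝓞 (κ.layer 2) →+* 𝓞 (κ.layer 2)) = Ideal.span {f q, S₂ - S₁ * S₂ - (t : 𝓞 (κ.layer 2))} ∧
      (∀ e : ℕ → ℕ, ((Finset.range 4 : Finset ℕ) : Set ℕ).Pairwise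
        (Function.onFun IsCoprime fun i => ((Ideal.span {f q, S₂ - (t : 𝓞 (κ.layer 2))}).map (intAut (σ ^ i) : 𝓞 (κ.layer 2) →+* 𝓞 (κ.layer 2))) ^ e i)) ∧
      (∀ τ : (κ.layer 2) ≃ₐ[K] (κ.layer 2),
        Ideal.relNorm (𝓞 K) ((Ideal.span {f q, S₂ - (t : 𝓞 (κ.layer 2))}).map (intAut τ : 𝓞 (κ.layer 2) →+* 𝓞 (κ.layer 2))) = Ideal.span {q}) ∧
      Ideal.relNorm (𝓞 K) (Ideal.span {f q, S₂ - (t : 𝓞 (κ.layer 2))}) = Ideal.span {q} := by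
    intro q hq t m hm ψ hψ ti hti hPt α β hBez αa va hCa αb vb hCb αc vc hCc
    have hq0 : q ≠ 0 := fun h0 => by
      rw [h0, Ideal.span_singleton_zero] at hq
      exact Ring.ne_bot_of_isMaximal_of_not_isField hq (RingOfIntegers.not_isField K) rfl
    set b : 𝓞 (κ.layer 2) := f q with hb
    have hbL : algebraMap (𝓞 (κ.layer 2)) (κ.layer 2) b = algebraMap K (κ.layer 2) (q : K) := by rw [hb, hcoe]
    have hb0 : b ≠ 0 := fun h => hq0 (by
      have h' : algebraMap (𝓞 (κ.layer 2)) (κ.layer 2) b = 0 := by rw [h, map_zero]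
      rw [hbL, map_eq_zero_iff _ (algebraMap K (κ.layer 2)).injective] at h'
      exact RingOfIntegers.coe_injective (by simpa using h'))
    have hI0 : Ideal.span {b, S₂ - (t : 𝓞 (κ.layer 2))} ≠ ⊥ := fun h => hb0 (by
      have : b ∈ Ideal.span {b, S₂ - (t : 𝓞 (κ.layer 2))} := Ideal.subset_span (by simp)
      rw [h, Ideal.mem_bot] at this
      exact this)
    have hmapI : ∀ (τ : (κ.layer 2) ≃ₐ[K] (κ.layer 2)) (Z : 𝓞 (κ.layer 2)), algebraMap (𝓞 (κ.layer 2)) (κ.layer 2) Z = τ s₂ - t →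
        (Ideal.span {b, S₂ - (t : 𝓞 (κ.layer 2))}).map (intAut τ : 𝓞 (κ.layer 2) →+* 𝓞 (κ.layer 2)) = Ideal.span {b, Z} := by
      intro τ Z hZ
      rw [Ideal.map_span, Set.image_pair]
      have h1 : (intAut τ : 𝓞 (κ.layer 2) →+* 𝓞 (κ.layer 2)) b = b := by
        apply RingOfIntegers.coe_injective
        rw [hia, hbL]
        exact τ.commutes _
      have h2 : (intAut τ : 𝓞 (κ.layer 2) →+* 𝓞 (κ.layer 2)) (S₂ - t) = Z := by
        apply RingOfIntegers.coe_injective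
        rw [hia, hZ, map_sub, map_intCast, hS₂val, map_sub, map_intCast]
      rw [h1, h2]
    have hJ₀ := hmapI (σ ^ 0) _ (hZ₀ t)
    have hJ₁ := hmapI (σ ^ 1) _ (hZ₁ t)
    have hJ₂ := hmapI (σ ^ 2) _ (hZ₂ t)
    have hJ₃ := hmapI (σ ^ 3) _ (hZ₃ t)
    -- coprimality of the four conjugates
    have hcomax₁ : f αa * b + (-(f va) * (S₁ + S₂ * (t : 𝓞 (κ.layer 2)) + (t : 𝓞 (κ.layer 2)) ^ 2 - 1)) * (S₂ - (t : 𝓞 (κ.layer 2))) +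
        f va * (S₁ * S₂ - S₂ - (t : 𝓞 (κ.layer 2))) = 1 := by
      have h := congrArg f hCa
      simp only [map_add, map_mul, map_one, map_intCast, map_pow, map_sub, map_ofNat] at h
      rw [hb]
      linear_combination h + (-(f va) * (t : 𝓞 (κ.layer 2))) * hS₂
    have hcomax₂ : f αb * b + (f vb) * (S₂ - (t : 𝓞 (κ.layer 2))) + f vb * (-S₂ - (t : 𝓞 (κ.layer 2))) = 1 := by
      have h := congrArg f hCb
      simp only [map_add, map_mul, map_one, map_intCast, map_neg, map_ofNat] at h
      rw [hb]
      linear_combination h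
    have hcomax₃ : f αc * b + (f vc * (S₁ + S₂ * (t : 𝓞 (κ.layer 2)) + (t : 𝓞 (κ.layer 2)) ^ 2 - 1)) * (S₂ - (t : 𝓞 (κ.layer 2))) +
        f vc * (S₂ - S₁ * S₂ - (t : 𝓞 (κ.layer 2))) = 1 := by
      have h := congrArg f hCc
      simp only [map_add, map_mul, map_one, map_intCast, map_pow, map_neg, map_ofNat] at h
      rw [hb]
      linear_combination h + (f vc * (t : 𝓞 (κ.layer 2))) * hS₂
    have hcop : ∀ k, 0 < k → k < 4 →
        Ideal.span {b, S₂ - (t : 𝓞 (κ.layer 2))} ⊔ (Ideal.span {b, S₂ - (t : 𝓞 (κ.layer 2))}).map (intAut (σ ^ k) : 𝓞 (κ.layer 2) →+* 𝓞 (κ.layer 2)) = ⊤ := by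
      intro k hk0 hk4
      interval_cases k
      · rw [hJ₁]; exact span_pair_sup_span_pair_eq_top_of_comax hcomax₁
      · rw [hJ₂]; exact span_pair_sup_span_pair_eq_top_of_comax hcomax₂
      · rw [hJ₃]; exact span_pair_sup_span_pair_eq_top_of_comax hcomax₃
    have hpair : ∀ e : ℕ → ℕ, ((Finset.range 4 : Finset ℕ) : Set ℕ).Pairwise
        (Function.onFun IsCoprime fun i => ((Ideal.span {b, S₂ - (t : 𝓞 (κ.layer 2))}).map (intAut (σ ^ i) : 𝓞 (κ.layer 2) →+* 𝓞 (κ.layer 2))) ^ e i) := by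
      intro e
      have key : ∀ i j : ℕ, i < j → j < 4 → IsCoprime (((Ideal.span {b, S₂ - (t : 𝓞 (κ.layer 2))}).map (intAut (σ ^ i) : 𝓞 (κ.layer 2) →+* 𝓞 (κ.layer 2))) ^ e i)
          (((Ideal.span {b, S₂ - (t : 𝓞 (κ.layer 2))}).map (intAut (σ ^ j) : 𝓞 (κ.layer 2) →+* 𝓞 (κ.layer 2))) ^ e j) := by
        intro i j hij hj4
        rw [Ideal.isCoprime_iff_sup_eq]
        apply Ideal.pow_sup_pow_eq_top
        have h := congrArg (Ideal.map (intAut (σ ^ i) : 𝓞 (κ.layer 2) →+* 𝓞 (κ.layer 2))) (hcop (j - i) (by omega) (by omega))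
        rw [Ideal.map_sup, Ideal.map_top, Ideal.map_map, hcomp i (j - i), show i + (j - i) = j by omega] at h
        exact h
      intro i hi j hj hij
      rw [Finset.coe_range, Set.mem_Iio] at hi hj
      rcases Nat.lt_or_gt_of_ne hij with h | h
      · exact key i j h hj
      · exact (key j i h hi).symm
    -- the norm `N(q, S₂ − t) = (q)`
    have hnormq : Algebra.intNorm (𝓞 K) (𝓞 (κ.layer 2)) b = q ^ 4 := by
      apply RingOfIntegers.coe_injective
      rw [Algebra.algebraMap_intNorm (A := 𝓞 K) (K := K) (L := κ.layer 2) (B := 𝓞 (κ.layer 2)) b, hbL, Algebra.norm_algebraMap, hdeg4, map_pow]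
    have hnormz : Algebra.intNorm (𝓞 K) (𝓞 (κ.layer 2)) (S₂ - t) = ((t : 𝓞 K) ^ 2 - 2) ^ 2 - 2 := by
      apply RingOfIntegers.coe_injective
      rw [Algebra.algebraMap_intNorm (A := 𝓞 K) (K := K) (L := κ.layer 2) (B := 𝓞 (κ.layer 2)) (S₂ - t), map_sub, map_intCast, hS₂val]
      have hz : (s₂ - t : κ.layer 2) = algebraMap K (κ.layer 2) (-(t : K)) + algebraMap K (κ.layer 2) 0 * algebraMap (κ.layer 1) (κ.layer 2) s₁
          + (algebraMap K (κ.layer 2) 1 + algebraMap K (κ.layer 2) 0 * algebraMap (κ.layer 1) (κ.layer 2) s₁) * s₂ := by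
        simp only [map_neg, map_intCast, map_zero, map_one]; ring
      rw [hz, norm_tower2_eq hdeg1 hdeg2 hs₁ hs₁K hs₂ hs₂K (-(t : K)) 0 1 0]
      simp only [map_sub, map_pow, map_intCast, map_ofNat]
      ring
    have hqmem : q ∈ Ideal.relNorm (𝓞 K) (Ideal.span {b, S₂ - (t : 𝓞 (κ.layer 2))}) := by
      have h1 : Algebra.intNorm (𝓞 K) (𝓞 (κ.layer 2)) b ∈ Ideal.relNorm (𝓞 K) (Ideal.span {b, S₂ - (t : 𝓞 (κ.layer 2))}) :=
        Ideal.intNorm_mem_spanNorm (R := 𝓞 K) (Ideal.subset_span (by simp))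
      have h2 : Algebra.intNorm (𝓞 K) (𝓞 (κ.layer 2)) (S₂ - t) ∈ Ideal.relNorm (𝓞 K) (Ideal.span {b, S₂ - (t : 𝓞 (κ.layer 2))}) :=
        Ideal.intNorm_mem_spanNorm (R := 𝓞 K) (Ideal.subset_span (by simp))
      rw [hnormq] at h1
      rw [hnormz] at h2
      rw [← hBez]
      exact Ideal.add_mem _ (Ideal.mul_mem_left _ _ h1) (Ideal.mul_mem_left _ _ h2)
    have hI0top : Ideal.span {b, S₂ - (t : 𝓞 (κ.layer 2))} ≠ ⊤ := by
      rw [hb]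
      exact span_pair_ne_top_of_residue_tower2 hdeg1 hdeg2 hs₁ hs₁K hs₂ hs₂K q t hm ψ hψ hti hPt hS₂val
    have hNI₀ : Ideal.relNorm (𝓞 K) (Ideal.span {b, S₂ - (t : 𝓞 (κ.layer 2))}) = Ideal.span {q} := by
      have hle : Ideal.span {q} ≤ Ideal.relNorm (𝓞 K) (Ideal.span {b, S₂ - (t : 𝓞 (κ.layer 2))}) := (Ideal.span_singleton_le_iff_mem _).mpr hqmem
      have hne : Ideal.relNorm (𝓞 K) (Ideal.span {b, S₂ - (t : 𝓞 (κ.layer 2))}) ≠ ⊤ := fun htop => hI0top (by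
        have h := Ideal.relNorm_le_comap (𝓞 K) (Ideal.span {b, S₂ - (t : 𝓞 (κ.layer 2))})
        rw [htop, top_le_iff, Ideal.comap_eq_top_iff] at h
        exact h)
      exact (hq.eq_of_le hne hle).symm
    have hconj : ∀ τ : (κ.layer 2) ≃ₐ[K] (κ.layer 2),
        Ideal.relNorm (𝓞 K) ((Ideal.span {b, S₂ - (t : 𝓞 (κ.layer 2))}).map (intAut τ : 𝓞 (κ.layer 2) →+* 𝓞 (κ.layer 2))) = Ideal.span {q} := by
      intro τ
      have hpt : ∀ x : 𝓞 (κ.layer 2), (intAut τ : 𝓞 (κ.layer 2) →+* 𝓞 (κ.layer 2)) x = galRestrict (𝓞 K) K (κ.layer 2) (𝓞 (κ.layer 2)) τ x := by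
        intro x
        apply RingOfIntegers.coe_injective
        rw [hia, algebraMap_galRestrict_apply]
      have hmap : (Ideal.span {b, S₂ - (t : 𝓞 (κ.layer 2))}).map (intAut τ : 𝓞 (κ.layer 2) →+* 𝓞 (κ.layer 2)) =
          (Ideal.span {b, S₂ - (t : 𝓞 (κ.layer 2))}).map (galRestrict (𝓞 K) K (κ.layer 2) (𝓞 (κ.layer 2)) τ) := by
        unfold Ideal.map
        congr 1
        ext w
        simp only [Set.mem_image, SetLike.mem_coe, hpt]
      rw [hmap, Ideal.relNorm_map_algEquiv, hNI₀]
    exact ⟨hb0, hI0, hJ₀, hJ₁, hJ₂, hJ₃, hpair, hconj, hNI₀⟩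
  -- ### the two primes
  obtain ⟨hb₁0, hI₁, hJ₁₀, hJ₁₁, hJ₁₂, hJ₁₃, hpair₁, hconj₁, hNI₁⟩ :=
    prime_block q₁ hq₁ t₁ hm₁ ψ₁ hψ₁ hti₁ hPt₁ α₁ β₁ hBez₁ α₁₁ v₁₁ hC₁₁ α₁₂ v₁₂ hC₁₂ α₁₃ v₁₃ hC₁₃
  obtain ⟨hb₂0, hI₂, hJ₂₀, hJ₂₁, hJ₂₂, hJ₂₃, hpair₂, hconj₂, hNI₂⟩ :=
    prime_block q₂ hq₂ t₂ hm₂ ψ₂ hψ₂ hti₂ hPt₂ α₂ β₂ hBez₂ α₂₁ v₂₁ hC₂₁ α₂₂ v₂₂ hC₂₂ α₂₃ v₂₃ hC₂₃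
  have hq₁0 : q₁ ≠ 0 := fun h0 => hb₁0 (by rw [h0, map_zero])
  have hq₂0 : q₂ ≠ 0 := fun h0 => hb₂0 (by rw [h0, map_zero])
  set I₁ : Ideal (𝓞 (κ.layer 2)) := Ideal.span {f q₁, S₂ - (t₁ : 𝓞 (κ.layer 2))} with hI₁def
  set I₂ : Ideal (𝓞 (κ.layer 2)) := Ideal.span {f q₂, S₂ - (t₂ : 𝓞 (κ.layer 2))} with hI₂def
  -- conjugates of different primes are coprime
  have hcross : ∀ i j : ℕ, IsCoprime (I₁.map (intAut (σ ^ i) : 𝓞 (κ.layer 2) →+* 𝓞 (κ.layer 2))) (I₂.map (intAut (σ ^ j) : 𝓞 (κ.layer 2) →+* 𝓞 (κ.layer 2))) := by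
    intro i j
    rw [Ideal.isCoprime_iff_sup_eq, hI₁def, hI₂def, Ideal.map_span, Ideal.map_span, Set.image_pair, Set.image_pair]
    have h1 : (intAut (σ ^ i) : 𝓞 (κ.layer 2) →+* 𝓞 (κ.layer 2)) (f q₁) = f q₁ := by
      apply RingOfIntegers.coe_injective; rw [hia, hcoe]; exact (σ ^ i).commutes _
    have h2 : (intAut (σ ^ j) : 𝓞 (κ.layer 2) →+* 𝓞 (κ.layer 2)) (f q₂) = f q₂ := by
      apply RingOfIntegers.coe_injective; rw [hia, hcoe]; exact (σ ^ j).commutes _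
    rw [h1, h2]
    have h := congrArg f hq₁₂
    simp only [map_add, map_mul, map_one] at h
    exact span_pair_sup_span_pair_eq_top_of_comax_left _ _ h
  -- ### ONE ROW: memberships + norm ⟹ the class relation — uniformly in the row data
  have row_block : ∀ (e g' : ℕ → ℕ) (w₀ w₁ w₂ w₃ : 𝓞 K)
      (hw1q0 : ∀ (R : Type) [CommRing R] (φ : 𝓞 K →+* R) (S₁ S₂ : R), S₁ ^ 2 = 2 → S₂ ^ 2 = 2 + S₁ →
        ∃ c : ℕ → R, φ w₀ + φ w₁ * S₁ + (φ w₂ + φ w₃ * S₁) * S₂ = ∑ k ∈ Finset.range (e 0 + 1), c k * φ q₁ ^ (e 0 - k) * (S₂ - (t₁ : R)) ^ k)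
      (hw1q1 : ∀ (R : Type) [CommRing R] (φ : 𝓞 K →+* R) (S₁ S₂ : R), S₁ ^ 2 = 2 → S₂ ^ 2 = 2 + S₁ →
        ∃ c : ℕ → R, φ w₀ + φ w₁ * S₁ + (φ w₂ + φ w₃ * S₁) * S₂ = ∑ k ∈ Finset.range (e 1 + 1), c k * φ q₁ ^ (e 1 - k) * (S₁ * S₂ - S₂ - (t₁ : R)) ^ k)
      (hw1q2 : ∀ (R : Type) [CommRing R] (φ : 𝓞 K →+* R) (S₁ S₂ : R), S₁ ^ 2 = 2 → S₂ ^ 2 = 2 + S₁ →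
        ∃ c : ℕ → R, φ w₀ + φ w₁ * S₁ + (φ w₂ + φ w₃ * S₁) * S₂ = ∑ k ∈ Finset.range (e 2 + 1), c k * φ q₁ ^ (e 2 - k) * (-S₂ - (t₁ : R)) ^ k)
      (hw1q3 : ∀ (R : Type) [CommRing R] (φ : 𝓞 K →+* R) (S₁ S₂ : R), S₁ ^ 2 = 2 → S₂ ^ 2 = 2 + S₁ →
        ∃ c : ℕ → R, φ w₀ + φ w₁ * S₁ + (φ w₂ + φ w₃ * S₁) * S₂ = ∑ k ∈ Finset.range (e 3 + 1), c k * φ q₁ ^ (e 3 - k) * (S₂ - S₁ * S₂ - (t₁ : R)) ^ k)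
      (hw2q0 : ∀ (R : Type) [CommRing R] (φ : 𝓞 K →+* R) (S₁ S₂ : R), S₁ ^ 2 = 2 → S₂ ^ 2 = 2 + S₁ →
        ∃ c : ℕ → R, φ w₀ + φ w₁ * S₁ + (φ w₂ + φ w₃ * S₁) * S₂ = ∑ k ∈ Finset.range (g' 0 + 1), c k * φ q₂ ^ (g' 0 - k) * (S₂ - (t₂ : R)) ^ k)
      (hw2q1 : ∀ (R : Type) [CommRing R] (φ : 𝓞 K →+* R) (S₁ S₂ : R), S₁ ^ 2 = 2 → S₂ ^ 2 = 2 + S₁ →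
        ∃ c : ℕ → R, φ w₀ + φ w₁ * S₁ + (φ w₂ + φ w₃ * S₁) * S₂ = ∑ k ∈ Finset.range (g' 1 + 1), c k * φ q₂ ^ (g' 1 - k) * (S₁ * S₂ - S₂ - (t₂ : R)) ^ k)
      (hw2q2 : ∀ (R : Type) [CommRing R] (φ : 𝓞 K →+* R) (S₁ S₂ : R), S₁ ^ 2 = 2 → S₂ ^ 2 = 2 + S₁ →
        ∃ c : ℕ → R, φ w₀ + φ w₁ * S₁ + (φ w₂ + φ w₃ * S₁) * S₂ = ∑ k ∈ Finset.range (g' 2 + 1), c k * φ q₂ ^ (g' 2 - k) * (-S₂ - (t₂ : R)) ^ k)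
      (hw2q3 : ∀ (R : Type) [CommRing R] (φ : 𝓞 K →+* R) (S₁ S₂ : R), S₁ ^ 2 = 2 → S₂ ^ 2 = 2 + S₁ →
        ∃ c : ℕ → R, φ w₀ + φ w₁ * S₁ + (φ w₂ + φ w₃ * S₁) * S₂ = ∑ k ∈ Finset.range (g' 3 + 1), c k * φ q₂ ^ (g' 3 - k) * (S₂ - S₁ * S₂ - (t₂ : R)) ^ k)
      (εw : (𝓞 K)ˣ) (hNw : (w₀ ^ 2 + 2 * w₁ ^ 2 - 2 * w₂ ^ 2 - 4 * w₃ ^ 2 - 4 * w₂ * w₃) ^ 2 - 2 * (2 * w₀ * w₁ - w₂ ^ 2 - 2 * w₃ ^ 2 - 4 * w₂ * w₃) ^ 2 =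
        εw * q₁ ^ (∑ i ∈ range 4, e i) * q₂ ^ (∑ i ∈ range 4, g' i)),
      (∏ i ∈ range 4, (ClassGroup.mulEquiv (intAut (σ ^ i)) (ClassGroup.mk0 ⟨I₁, mem_nonZeroDivisors_of_ne_zero hI₁⟩)) ^ ((e i : ℕ) : ℤ)) *
        ∏ i ∈ range 4, (ClassGroup.mulEquiv (intAut (σ ^ i)) (ClassGroup.mk0 ⟨I₂, mem_nonZeroDivisors_of_ne_zero hI₂⟩)) ^ ((g' i : ℕ) : ℤ) = 1 := by
    intro e g' w₀ w₁ w₂ w₃ hw1q0 hw1q1 hw1q2 hw1q3 hw2q0 hw2q1 hw2q2 hw2q3 εw hNw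
    obtain ⟨Y, hYdef⟩ : ∃ Y : 𝓞 (κ.layer 2), Y = f w₀ + f w₁ * S₁ + (f w₂ + f w₃ * S₁) * S₂ := ⟨_, rfl⟩
    -- memberships
    have hY₁ : ∀ i ∈ Finset.range 4, Y ∈ (I₁.map (intAut (σ ^ i) : 𝓞 (κ.layer 2) →+* 𝓞 (κ.layer 2))) ^ e i := by
      intro i hi
      rw [Finset.mem_range] at hi
      interval_cases i
      · obtain ⟨c, hc⟩ := hw1q0 (𝓞 (κ.layer 2)) f S₁ S₂ hS₁ hS₂
        rw [hJ₁₀, hYdef, hc]; exact sum_mul_pow_mul_pow_mem_span_pair_pow _ _ _ _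
      · obtain ⟨c, hc⟩ := hw1q1 (𝓞 (κ.layer 2)) f S₁ S₂ hS₁ hS₂
        rw [hJ₁₁, hYdef, hc]; exact sum_mul_pow_mul_pow_mem_span_pair_pow _ _ _ _
      · obtain ⟨c, hc⟩ := hw1q2 (𝓞 (κ.layer 2)) f S₁ S₂ hS₁ hS₂
        rw [hJ₁₂, hYdef, hc]; exact sum_mul_pow_mul_pow_mem_span_pair_pow _ _ _ _
      · obtain ⟨c, hc⟩ := hw1q3 (𝓞 (κ.layer 2)) f S₁ S₂ hS₁ hS₂
        rw [hJ₁₃, hYdef, hc]; exact sum_mul_pow_mul_pow_mem_span_pair_pow _ _ _ _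
    have hY₂ : ∀ i ∈ Finset.range 4, Y ∈ (I₂.map (intAut (σ ^ i) : 𝓞 (κ.layer 2) →+* 𝓞 (κ.layer 2))) ^ g' i := by
      intro i hi
      rw [Finset.mem_range] at hi
      interval_cases i
      · obtain ⟨c, hc⟩ := hw2q0 (𝓞 (κ.layer 2)) f S₁ S₂ hS₁ hS₂
        rw [hJ₂₀, hYdef, hc]; exact sum_mul_pow_mul_pow_mem_span_pair_pow _ _ _ _
      · obtain ⟨c, hc⟩ := hw2q1 (𝓞 (κ.layer 2)) f S₁ S₂ hS₁ hS₂
        rw [hJ₂₁, hYdef, hc]; exact sum_mul_pow_mul_pow_mem_span_pair_pow _ _ _ _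
      · obtain ⟨c, hc⟩ := hw2q2 (𝓞 (κ.layer 2)) f S₁ S₂ hS₁ hS₂
        rw [hJ₂₂, hYdef, hc]; exact sum_mul_pow_mul_pow_mem_span_pair_pow _ _ _ _
      · obtain ⟨c, hc⟩ := hw2q3 (𝓞 (κ.layer 2)) f S₁ S₂ hS₁ hS₂
        rw [hJ₂₃, hYdef, hc]; exact sum_mul_pow_mul_pow_mem_span_pair_pow _ _ _ _
    set A₁ : Ideal (𝓞 (κ.layer 2)) := ∏ i ∈ Finset.range 4, (I₁.map (intAut (σ ^ i) : 𝓞 (κ.layer 2) →+* 𝓞 (κ.layer 2))) ^ e i with hA₁def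
    set A₂ : Ideal (𝓞 (κ.layer 2)) := ∏ i ∈ Finset.range 4, (I₂.map (intAut (σ ^ i) : 𝓞 (κ.layer 2) →+* 𝓞 (κ.layer 2))) ^ g' i with hA₂def
    have hYA₁ : Y ∈ A₁ := by
      rw [hA₁def, Ideal.prod_eq_iInf_of_pairwise_isCoprime (hpair₁ e)]
      exact (Submodule.mem_iInf _).mpr fun i => (Submodule.mem_iInf _).mpr fun hi => hY₁ i hi
    have hYA₂ : Y ∈ A₂ := by
      rw [hA₂def, Ideal.prod_eq_iInf_of_pairwise_isCoprime (hpair₂ g')]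
      exact (Submodule.mem_iInf _).mpr fun i => (Submodule.mem_iInf _).mpr fun hi => hY₂ i hi
    have hA₁₂ : IsCoprime A₁ A₂ := by
      rw [hA₁def, hA₂def]
      refine IsCoprime.prod_left fun i _ => IsCoprime.prod_right fun j _ => ?_
      exact (IsCoprime.pow (hcross i j))
    have hYA : Y ∈ A₁ * A₂ := by
      rw [Ideal.mul_eq_inf_of_isCoprime hA₁₂]
      exact ⟨hYA₁, hYA₂⟩
    -- norms
    have hrelNormA : Ideal.relNorm (𝓞 K) (A₁ * A₂) = Ideal.span {q₁} ^ (∑ i ∈ range 4, e i) * Ideal.span {q₂} ^ (∑ i ∈ range 4, g' i) := by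
      rw [map_mul, hA₁def, hA₂def, map_prod, map_prod]
      simp_rw [map_pow, hconj₁, hconj₂]
      rw [Finset.prod_pow_eq_pow_sum, Finset.prod_pow_eq_pow_sum]
    have hnormy : Algebra.intNorm (𝓞 K) (𝓞 (κ.layer 2)) Y = εw * q₁ ^ (∑ i ∈ range 4, e i) * q₂ ^ (∑ i ∈ range 4, g' i) := by
      apply RingOfIntegers.coe_injective
      rw [Algebra.algebraMap_intNorm (A := 𝓞 K) (K := K) (L := κ.layer 2) (B := 𝓞 (κ.layer 2))]
      have hz : algebraMap (𝓞 (κ.layer 2)) (κ.layer 2) Y =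
          algebraMap K (κ.layer 2) (w₀ : K) + algebraMap K (κ.layer 2) (w₁ : K) * algebraMap (κ.layer 1) (κ.layer 2) s₁
          + (algebraMap K (κ.layer 2) (w₂ : K) + algebraMap K (κ.layer 2) (w₃ : K) * algebraMap (κ.layer 1) (κ.layer 2) s₁) * s₂ := by
        rw [hYdef]; simp only [map_add, map_mul, hcoe, hS₁val, hS₂val]
      have gN := congrArg (algebraMap (𝓞 K) K) hNw
      simp only [map_add, map_sub, map_mul, map_pow, map_ofNat] at gN
      rw [hz, norm_tower2_eq hdeg1 hdeg2 hs₁ hs₁K hs₂ hs₂K]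
      exact gN
    -- `(Y) = A₁ A₂`
    have hyA : Ideal.span {Y} = A₁ * A₂ := by
      have hle := (Ideal.span_singleton_le_iff_mem _).mpr hYA
      obtain ⟨Cc, hC⟩ := Ideal.dvd_iff_le.mpr hle
      have hNy : Ideal.relNorm (𝓞 K) (Ideal.span {Y}) = Ideal.span {q₁} ^ (∑ i ∈ range 4, e i) * Ideal.span {q₂} ^ (∑ i ∈ range 4, g' i) := by
        rw [Ideal.relNorm_singleton, hnormy, Ideal.span_singleton_pow, Ideal.span_singleton_pow, Ideal.span_singleton_mul_span_singleton]
        exact Ideal.span_singleton_eq_span_singleton.mpr ⟨εw⁻¹, by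
          rw [mul_assoc (εw : 𝓞 K), mul_comm (εw : 𝓞 K), mul_assoc, Units.mul_inv, mul_one]⟩
      have hne : Ideal.span {q₁} ^ (∑ i ∈ range 4, e i) * Ideal.span {q₂} ^ (∑ i ∈ range 4, g' i) ≠ 0 :=
        mul_ne_zero (pow_ne_zero _ (by rw [Ne, Ideal.zero_eq_bot, Ideal.span_singleton_eq_bot]; exact hq₁0))
          (pow_ne_zero _ (by rw [Ne, Ideal.zero_eq_bot, Ideal.span_singleton_eq_bot]; exact hq₂0))
      have hNC : Ideal.relNorm (𝓞 K) Cc = ⊤ := by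
        have h := congrArg (Ideal.relNorm (𝓞 K)) hC
        rw [map_mul, hNy, hrelNormA] at h
        have h' : (Ideal.span {q₁} ^ (∑ i ∈ range 4, e i) * Ideal.span {q₂} ^ (∑ i ∈ range 4, g' i)) * Ideal.relNorm (𝓞 K) Cc =
            (Ideal.span {q₁} ^ (∑ i ∈ range 4, e i) * Ideal.span {q₂} ^ (∑ i ∈ range 4, g' i)) * ⊤ := by rw [Ideal.mul_top]; exact h.symm
        exact mul_left_cancel₀ hne h'
      have hCtop : Cc = ⊤ := by
        by_contra hC'
        obtain ⟨M, hM, hCM⟩ := Ideal.exists_le_maximal Cc hC'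
        have h := Ideal.relNorm_mono (𝓞 K) hCM
        rw [hNC, top_le_iff] at h
        haveI := hM
        haveI : (M.under (𝓞 K)).IsMaximal := Ideal.IsMaximal.under (𝓞 K) M
        rw [Ideal.relNorm_eq_pow_of_isMaximal M (M.under (𝓞 K)), Ideal.pow_eq_top_iff] at h
        rcases h with h | h
        · exact (Ideal.IsMaximal.ne_top inferInstance) h
        · exact (Ideal.inertiaDeg_pos M (R := 𝓞 K)).ne' h
      rw [hC, hCtop, Ideal.mul_top]
    exact prod_pow_mul_prod_pow_mulEquiv_intAut_mk0_eq_one (F := K) σ hI₁ hI₂ hyA.symm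
  have hrel₁ := row_block e₁ g₁ y₀ y₁ y₂ y₃ hy1q0 hy1q1 hy1q2 hy1q3 hy2q0 hy2q1 hy2q2 hy2q3 εy hNy
  have hrel₂ := row_block e₂ g₂ z₀ z₁ z₂ z₃ hz1q0 hz1q1 hz1q2 hz1q3 hz2q0 hz2q1 hz2q2 hz2q3 εz hNz
  -- ### the genus certificates `N_{K₂/K₁} I₁`, `N_{K₂/K₁} I₂`, `N_{K₂/K₁} (I₁ I₂)`
  have hI₁₂ : I₁ * I₂ ≠ ⊥ := mul_ne_zero hI₁ hI₂
  have hA₁0 : Ideal.relNorm (𝓞 (κ.layer 1)) I₁ ≠ ⊥ := (Ideal.relNorm_eq_bot_iff (R := 𝓞 (κ.layer 1))).not.mpr hI₁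
  have hA₂0 : Ideal.relNorm (𝓞 (κ.layer 1)) I₂ ≠ ⊥ := (Ideal.relNorm_eq_bot_iff (R := 𝓞 (κ.layer 1))).not.mpr hI₂
  have hA₁₂0 : Ideal.relNorm (𝓞 (κ.layer 1)) (I₁ * I₂) ≠ ⊥ := (Ideal.relNorm_eq_bot_iff (R := 𝓞 (κ.layer 1))).not.mpr hI₁₂
  have hA₁ : Ideal.relNorm (𝓞 K) (Ideal.relNorm (𝓞 (κ.layer 1)) I₁) ^ 1 = Ideal.span {q₁} := by rw [pow_one, Ideal.relNorm_relNorm, hNI₁]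
  have hA₂ : Ideal.relNorm (𝓞 K) (Ideal.relNorm (𝓞 (κ.layer 1)) I₂) ^ 1 = Ideal.span {q₂} := by rw [pow_one, Ideal.relNorm_relNorm, hNI₂]
  have hA₁₂ : Ideal.relNorm (𝓞 K) (Ideal.relNorm (𝓞 (κ.layer 1)) (I₁ * I₂)) ^ 1 = Ideal.span {q₁ * q₂} := by
    rw [pow_one, Ideal.relNorm_relNorm, map_mul, hNI₁, hNI₂, Ideal.span_singleton_mul_span_singleton]
  have hcA₁ : classGroupNorm (κ.layer 1) (κ.layer 2) (ClassGroup.mk0 ⟨I₁, mem_nonZeroDivisors_of_ne_zero hI₁⟩) =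
      ClassGroup.mk0 ⟨Ideal.relNorm (𝓞 (κ.layer 1)) I₁, mem_nonZeroDivisors_of_ne_zero hA₁0⟩ :=
    classGroupNorm_mk0 (κ.layer 1) ⟨_, mem_nonZeroDivisors_of_ne_zero hI₁⟩
  have hcA₂ : classGroupNorm (κ.layer 1) (κ.layer 2) (ClassGroup.mk0 ⟨I₂, mem_nonZeroDivisors_of_ne_zero hI₂⟩) =
      ClassGroup.mk0 ⟨Ideal.relNorm (𝓞 (κ.layer 1)) I₂, mem_nonZeroDivisors_of_ne_zero hA₂0⟩ :=
    classGroupNorm_mk0 (κ.layer 1) ⟨_, mem_nonZeroDivisors_of_ne_zero hI₂⟩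
  have hmk12 : ClassGroup.mk0 ⟨I₁, mem_nonZeroDivisors_of_ne_zero hI₁⟩ * ClassGroup.mk0 ⟨I₂, mem_nonZeroDivisors_of_ne_zero hI₂⟩ =
      ClassGroup.mk0 (⟨I₁ * I₂, mem_nonZeroDivisors_of_ne_zero hI₁₂⟩ : (Ideal (𝓞 (κ.layer 2)))⁰) := by
    rw [← map_mul]; rfl
  have hcA₁₂ : classGroupNorm (κ.layer 1) (κ.layer 2)
      (ClassGroup.mk0 ⟨I₁, mem_nonZeroDivisors_of_ne_zero hI₁⟩ * ClassGroup.mk0 ⟨I₂, mem_nonZeroDivisors_of_ne_zero hI₂⟩) =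
      ClassGroup.mk0 ⟨Ideal.relNorm (𝓞 (κ.layer 1)) (I₁ * I₂), mem_nonZeroDivisors_of_ne_zero hA₁₂0⟩ := by
    rw [hmk12]
    exact classGroupNorm_mk0 (κ.layer 1) ⟨_, mem_nonZeroDivisors_of_ne_zero hI₁₂⟩
  -- ### the two-generator relation door
  exact classicalMuVanishes_two_of_relation_matrix_of_three_genusCerts hK2 hd κ hκ h3 hh (m := 2) one_le_two
    Pa hresa h2Pa hunitsa hπa hA₁0 hA₁ Pb hresb h2Pb hunitsb hπb hA₂0 hA₂ Pc hresc h2Pc hunitsc hπc hA₁₂0 hA₁₂ σ hgen hcA₁ hcA₂ hcA₁₂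
    (N := 4) (d := d) (show d + 2 ≤ 2 ^ 2 by norm_num; omega) hu hF hrel₁ hrel₂

end Layer

end Literature.NumberTheory.IwasawaTheory

end
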